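import Mathlib
import Literature.Analysis.UnboundedOperators.ConjugateOperatorRegularity
import HarnessLib
import Summits.AtomisticToContinuum.FouriersLaw.Theorems.EmbeddedDrudeMourreMourreDissolutionLAPRegularityAlgebra

/-!
# Stub `stub_mourreThresholdLAP` — Mourre LAP infrastructure 18: smearing along the conjugation group (regularisation `S_ρ = ∫ ρ(x) 𝒲(x)[S] dx`)

Item `stmt-AtomisticToContinuum-12594` (crux `MourreDissolution` of route `EmbeddedDrudeMourre`,
sub-problem `FouriersLaw`), line `separable-vertex-faddeev-pair-sector`, stub S6
`stub_mourreThresholdLAP` (Mourre's limiting absorption principle; NOT in the tree). Groundwork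
for step L5 of the proof map (the differential inequality, ABG §7.3): the REGULARISATION of a
bounded operator along the automorphism group `𝒲(x)[S] = e^{-iAx} S e^{iAx}` of the conjugate
operator (ABG Lemma 7.3.6, `S_ε = θ(ε𝒜)[S] = ∫ 𝒲(ετ)[S] θ̂(τ) dτ`, eqs. (7.3.16)–(7.3.19)), over the
tree's `ConjugateOperatorRegularity` and part 7 (`…LAPRegularityAlgebra`):

* §1 `conjSmear A ρ S = S_ρ`, `S_ρ f = ∫ ρ(x) 𝒲(x)[S] f dx` (vector-valued Bochner integral — the
  family `x ↦ 𝒲(x)[S]` is only strongly continuous), a bounded operator of norm `≤ ‖ρ‖₁ ‖S‖`;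
* §2 covariance `𝒲(y)[S_ρ] f = ∫ ρ(x) 𝒲(x + y)[S] f dx = ∫ ρ(u - y) 𝒲(u)[S] f du`, hence
  `S ∈ C¹(A; H) ⇒ S_ρ ∈ C¹(A; H)` with `[S_ρ, iA] = ([S, iA])_ρ` (ABG (7.3.19): `𝒜` commutes with
  `φ(ε𝒜)`), and the REGULARISING property: for a Schwartz kernel `ρ` and ANY bounded `S`,
  `S_ρ ∈ C¹(A; H)` with `[S_ρ, iA] = -S_{ρ'}` (differentiation of the translate under the integral
  sign; headline `conjSmear_schwartz_regular`);
* §3 distance to `S`: `S_ρ - S = ∫ ρ(x) (𝒲(x)[S] - S) dx` for `∫ ρ = 1`, so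
  `‖S_ρ f - S f‖ ≤ (∫ |x| |ρ(x)| dx) ‖[S, iA]‖ ‖f‖` for `S ∈ C¹(A; H)`.
-/

noncomputable section

open MeasureTheory Complex Filter Topology Set Metric
open scoped InnerProductSpace ComplexConjugate SchwartzMap ENNReal NNReal

namespace Summit.AtomisticToContinuum.FouriersLaw.Theorems.MourreDissolution

open Literature.Analysis.UnboundedOperators
open Literature.Analysis.UnboundedOperators.UnitaryRep

variable {H : Type*} [NormedAddCommGroup H] [InnerProductSpace ℂ H] [CompleteSpace H]

/-! ## §1. The smeared conjugate `S_ρ = ∫ ρ(x) 𝒲(x)[S] dx` -/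

/-- `‖c 𝒲(x)[S] f‖ ≤ ‖c‖ ‖S‖ ‖f‖`. [folklore] -/
theorem norm_smul_conjAut_apply_le (A : OneParameterUnitaryGroup H) (c : ℂ) (S : H →L[ℂ] H)
    (f : H) (x : ℝ) : ‖c • A.conjAut x S f‖ ≤ ‖c‖ * (‖S‖ * ‖f‖) := by
  rw [norm_smul]
  gcongr
  exact (ContinuousLinearMap.le_opNorm _ _).trans (by rw [norm_conjAut])

/-- For integrable `ρ`, `x ↦ ρ(x) 𝒲(x)[S] f` is Bochner integrable (strong continuity of `𝒲(·)[S] f`).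
[folklore] -/
theorem integrable_smul_conjAut_apply (A : OneParameterUnitaryGroup H) {ρ : ℝ → ℂ}
    (hρ : Integrable ρ) (S : H →L[ℂ] H) (f : H) : Integrable fun x => ρ x • A.conjAut x S f :=
  (hρ.norm.mul_const (‖S‖ * ‖f‖)).mono'
    (hρ.aestronglyMeasurable.smul (continuous_conjAut_apply A S f).aestronglyMeasurable)
    (Eventually.of_forall fun x => norm_smul_conjAut_apply_le A (ρ x) S f x)

/-- `‖∫ ρ(x) 𝒲(x)[S] f dx‖ ≤ ‖ρ‖₁ ‖S‖ ‖f‖` for integrable `ρ`. [folklore] -/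
theorem norm_integral_smul_conjAut_apply_le (A : OneParameterUnitaryGroup H) {ρ : ℝ → ℂ}
    (hρ : Integrable ρ) (S : H →L[ℂ] H) (f : H) :
    ‖∫ x, ρ x • A.conjAut x S f‖ ≤ (∫ x, ‖ρ x‖) * ‖S‖ * ‖f‖ := by
  calc ‖∫ x, ρ x • A.conjAut x S f‖ ≤ ∫ x, ‖ρ x • A.conjAut x S f‖ := norm_integral_le_integral_norm _
    _ ≤ ∫ x, ‖ρ x‖ * (‖S‖ * ‖f‖) :=
        integral_mono_of_nonneg (Eventually.of_forall fun x => norm_nonneg _) (hρ.norm.mul_const _)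
          (Eventually.of_forall fun x => norm_smul_conjAut_apply_le A (ρ x) S f x)
    _ = (∫ x, ‖ρ x‖) * ‖S‖ * ‖f‖ := by rw [integral_mul_const, mul_assoc]

/-- Additivity of `f ↦ ∫ ρ(x) 𝒲(x)[S] f dx`. [folklore] -/
theorem integral_smul_conjAut_apply_add (A : OneParameterUnitaryGroup H) {ρ : ℝ → ℂ}
    (hρ : Integrable ρ) (S : H →L[ℂ] H) (f g : H) :
    ∫ x, ρ x • A.conjAut x S (f + g) = (∫ x, ρ x • A.conjAut x S f) + ∫ x, ρ x • A.conjAut x S g := by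
  rw [← integral_add (integrable_smul_conjAut_apply A hρ S f) (integrable_smul_conjAut_apply A hρ S g)]
  simp_rw [map_add, smul_add]

/-- Homogeneity of `f ↦ ∫ ρ(x) 𝒲(x)[S] f dx`. [folklore] -/
theorem integral_smul_conjAut_apply_smul (A : OneParameterUnitaryGroup H) (ρ : ℝ → ℂ)
    (S : H →L[ℂ] H) (c : ℂ) (f : H) :
    ∫ x, ρ x • A.conjAut x S (c • f) = c • ∫ x, ρ x • A.conjAut x S f := by
  rw [← integral_smul]
  simp_rw [map_smul, smul_comm (ρ _) c]

/-- **Smearing along the conjugation group** (ABG's `φ(𝒜)[S] = ∫ 𝒲(τ)[S] φ̂(τ) dτ`, (7.3.16)–(7.3.17)):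
`conjSmear A ρ S = S_ρ`, `S_ρ f = ∫ ρ(x) 𝒲(x)[S] f dx`, a bounded operator of norm `≤ ‖ρ‖₁ ‖S‖`
(vector-valued Bochner integral; junk value `0` for non-integrable `ρ`).
[cite: AmreinBoutetdeMonvelGeorgescu1996, Lemma 7.3.6] -/
def conjSmear (A : OneParameterUnitaryGroup H) (ρ : ℝ → ℂ) (S : H →L[ℂ] H) : H →L[ℂ] H := by
  classical
  exact if hρ : Integrable ρ then
    LinearMap.mkContinuous
      { toFun := fun f => ∫ x, ρ x • A.conjAut x S f
        map_add' := integral_smul_conjAut_apply_add A hρ S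
        map_smul' := integral_smul_conjAut_apply_smul A ρ S } ((∫ x, ‖ρ x‖) * ‖S‖)
      (fun f => norm_integral_smul_conjAut_apply_le A hρ S f)
  else 0

/-- `S_ρ f = ∫ ρ(x) 𝒲(x)[S] f dx` for integrable `ρ`. [folklore] -/
theorem conjSmear_apply (A : OneParameterUnitaryGroup H) {ρ : ℝ → ℂ} (hρ : Integrable ρ)
    (S : H →L[ℂ] H) (f : H) : conjSmear A ρ S f = ∫ x, ρ x • A.conjAut x S f := by
  rw [conjSmear, dif_pos hρ]
  rfl

/-- `‖S_ρ‖ ≤ ‖ρ‖₁ ‖S‖`. [cite: AmreinBoutetdeMonvelGeorgescu1996, Lemma 7.3.6] -/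
theorem norm_conjSmear_le (A : OneParameterUnitaryGroup H) {ρ : ℝ → ℂ} (hρ : Integrable ρ)
    (S : H →L[ℂ] H) : ‖conjSmear A ρ S‖ ≤ (∫ x, ‖ρ x‖) * ‖S‖ :=
  ContinuousLinearMap.opNorm_le_bound _ (by positivity) fun f => by
    rw [conjSmear_apply A hρ]
    exact norm_integral_smul_conjAut_apply_le A hρ S f

/-! ## §2. Covariance and commutators: `S ∈ C¹ ⇒ S_ρ ∈ C¹`, and `S_ρ ∈ C¹` for Schwartz `ρ` -/

/-- **Covariance**: `𝒲(y)[S_ρ] f = ∫ ρ(x) 𝒲(x + y)[S] f dx`. [folklore] -/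
theorem conjAut_conjSmear_apply (A : OneParameterUnitaryGroup H) {ρ : ℝ → ℂ} (hρ : Integrable ρ)
    (S : H →L[ℂ] H) (y : ℝ) (f : H) :
    A.conjAut y (conjSmear A ρ S) f = ∫ x, ρ x • A.conjAut (x + y) S f := by
  rw [conjAut_apply, conjSmear_apply A hρ,
    ← (A.appReal (-y)).integral_comp_comm (integrable_smul_conjAut_apply A hρ S _)]
  refine integral_congr_ae (Eventually.of_forall fun x => ?_)
  simp only [ContinuousLinearMap.map_smul]
  congr 1
  rw [add_comm, conjAut_add]
  rfl

/-- **Covariance, translated kernel**: `𝒲(y)[S_ρ] f = ∫ ρ(u - y) 𝒲(u)[S] f du`. [folklore] -/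
theorem conjAut_conjSmear_apply' (A : OneParameterUnitaryGroup H) {ρ : ℝ → ℂ} (hρ : Integrable ρ)
    (S : H →L[ℂ] H) (y : ℝ) (f : H) :
    A.conjAut y (conjSmear A ρ S) f = ∫ u, ρ (u - y) • A.conjAut u S f := by
  rw [conjAut_conjSmear_apply A hρ, ← integral_sub_right_eq_self _ y]
  simp only [sub_add_cancel]

/-- **`S ∈ C¹(A; H) ⇒ S_ρ ∈ C¹(A; H)` with `[S_ρ, iA] = ([S, iA])_ρ`** (the commutator passes under
the smearing; ABG (7.3.19): `𝒜 φ(ε𝒜)[S] = φ(ε𝒜)[𝒜S]`). Differentiation of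
`y ↦ ∫ ρ(x) 𝒲(x + y)[S] f dx` under the integral sign, dominated by `|ρ(x)| ‖[S, iA]‖ ‖f‖`.
[cite: AmreinBoutetdeMonvelGeorgescu1996, Lemma 7.3.6] -/
theorem hasCommutator_conjSmear {A : OneParameterUnitaryGroup H} {S D : H →L[ℂ] H}
    (h : A.HasCommutator S D) {ρ : ℝ → ℂ} (hρ : Integrable ρ) :
    A.HasCommutator (conjSmear A ρ S) (conjSmear A ρ D) := by
  intro f
  have key := (hasDerivAt_integral_of_dominated_loc_of_deriv_le
    (F := fun (y x : ℝ) => ρ x • A.conjAut (x + y) S f)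
    (F' := fun (y x : ℝ) => ρ x • A.conjAut (x + y) D f) (x₀ := (0 : ℝ)) (s := univ)
    (bound := fun x => ‖ρ x‖ * (‖D‖ * ‖f‖)) univ_mem ?_ ?_ ?_ ?_ (hρ.norm.mul_const _) ?_).2
  · have e1 : (fun y : ℝ => ∫ x, ρ x • A.conjAut (x + y) S f) = fun y => A.conjAut y (conjSmear A ρ S) f :=
      funext fun y => (conjAut_conjSmear_apply A hρ S y f).symm
    have e2 : (∫ x, ρ x • A.conjAut (x + 0) D f) = conjSmear A ρ D f := by
      simp only [add_zero]; exact (conjSmear_apply A hρ D f).symm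
    rwa [e1, e2] at key
  · refine Eventually.of_forall fun y => ?_
    exact hρ.aestronglyMeasurable.smul (((continuous_conjAut_apply A S f).comp
      (continuous_id.add continuous_const))).aestronglyMeasurable
  · simp only [add_zero]; exact integrable_smul_conjAut_apply A hρ S f
  · simp only [add_zero]
    exact hρ.aestronglyMeasurable.smul (continuous_conjAut_apply A D f).aestronglyMeasurable
  · exact Eventually.of_forall fun x y _ => norm_smul_conjAut_apply_le A (ρ x) D f (x + y)
  · refine Eventually.of_forall fun x y _ => ?_
    have h1 : HasDerivAt (fun y : ℝ => x + y) 1 y := (hasDerivAt_id' y).const_add x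
    have h2 := ((h.hasDerivAt_conjAut (x + y) f).scomp y h1).const_smul (ρ x)
    simp only [Function.comp_def, one_smul] at h2
    exact h2

/-- `S ∈ C¹ ⇒ S_ρ ∈ C¹` and `[S_ρ, iA] = ([S, iA])_ρ` in terms of `commutatorCLM`. [folklore] -/
theorem commutatorCLM_conjSmear {A : OneParameterUnitaryGroup H} {S : H →L[ℂ] H}
    (h : A.IsOfClassC1 S) {ρ : ℝ → ℂ} (hρ : Integrable ρ) :
    A.IsOfClassC1 (conjSmear A ρ S) ∧
      A.commutatorCLM (conjSmear A ρ S) = conjSmear A ρ (A.commutatorCLM S) :=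
  ⟨(hasCommutator_conjSmear h.hasCommutator hρ).isOfClassC1,
    (hasCommutator_conjSmear h.hasCommutator hρ).commutatorCLM_eq⟩

/-- **Uniform decay of the translates of a Schwartz function**: there is `C` with
`‖φ(u - y)‖ ≤ C (1 + |u|)⁻²` for all `|y| < 1` and all `u`. [folklore] -/
theorem schwartz_translate_le (φ : 𝓢(ℝ, ℂ)) :
    ∃ C : ℝ, 0 ≤ C ∧ ∀ y ∈ ball (0 : ℝ) 1, ∀ u : ℝ, ‖φ (u - y)‖ ≤ C * (1 + ‖u‖) ^ (-(2 : ℝ)) := by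
  set C₀ : ℝ := 2 ^ 2 * (Finset.Iic ((2, 0) : ℕ × ℕ)).sup
    (fun m => SchwartzMap.seminorm ℂ m.1 m.2) φ with hC₀
  have hC₀0 : 0 ≤ C₀ := by positivity
  have hdec : ∀ x : ℝ, (1 + ‖x‖) ^ 2 * ‖φ x‖ ≤ C₀ := fun x => by
    have := SchwartzMap.one_add_le_sup_seminorm_apply (𝕜 := ℂ) (m := ((2, 0) : ℕ × ℕ)) (k := 2)
      (n := 0) le_rfl le_rfl φ x
    rwa [norm_iteratedFDeriv_zero] at this
  refine ⟨4 * C₀, by positivity, fun y hy u => ?_⟩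
  rw [mem_ball, dist_zero_right] at hy
  have h1 : 0 < 1 + ‖u - y‖ := by positivity
  have h2 : 1 + ‖u‖ ≤ 2 * (1 + ‖u - y‖) := by
    have : ‖u‖ ≤ ‖u - y‖ + ‖y‖ := by
      calc ‖u‖ = ‖(u - y) + y‖ := by rw [sub_add_cancel]
        _ ≤ ‖u - y‖ + ‖y‖ := norm_add_le _ _
    linarith [norm_nonneg (u - y)]
  have h3 : ‖φ (u - y)‖ ≤ C₀ / (1 + ‖u - y‖) ^ 2 := by
    rw [le_div_iff₀ (by positivity), mul_comm]
    exact hdec (u - y)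
  have h4 : C₀ / (1 + ‖u - y‖) ^ 2 ≤ 4 * C₀ / (1 + ‖u‖) ^ 2 := by
    rw [div_le_div_iff₀ (by positivity) (by positivity)]
    have : (1 + ‖u‖) ^ 2 ≤ 4 * (1 + ‖u - y‖) ^ 2 := by nlinarith [h2, norm_nonneg u]
    nlinarith [this]
  calc ‖φ (u - y)‖ ≤ 4 * C₀ / (1 + ‖u‖) ^ 2 := h3.trans h4
    _ = 4 * C₀ * (1 + ‖u‖) ^ (-(2 : ℝ)) := by
        rw [Real.rpow_neg (by positivity), div_eq_mul_inv]
        norm_num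

/-- **Regularising property of Schwartz smearing**: for a Schwartz kernel `ρ` and ANY bounded `S`,
`S_ρ ∈ C¹(A; H)` with `[S_ρ, iA] = -S_{ρ'}` (differentiate `y ↦ ∫ ρ(u - y) 𝒲(u)[S] f du` under the
integral sign, dominated by the uniform decay of the translates of `ρ'`; ABG (7.3.18)–(7.3.19):
`𝒜 φ(𝒜) = φ₁(𝒜)`). [cite: AmreinBoutetdeMonvelGeorgescu1996, Lemma 7.3.6] -/
theorem hasCommutator_conjSmear_schwartz (A : OneParameterUnitaryGroup H) (ρ : 𝓢(ℝ, ℂ))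
    (S : H →L[ℂ] H) :
    A.HasCommutator (conjSmear A ρ S) (-conjSmear A (SchwartzMap.derivCLM ℂ ℂ ρ) S) := by
  intro f
  set ρ' : 𝓢(ℝ, ℂ) := SchwartzMap.derivCLM ℂ ℂ ρ with hρ'
  obtain ⟨C, hC0, hC⟩ := schwartz_translate_le ρ'
  have hbound : Integrable (fun u : ℝ => C * (1 + ‖u‖) ^ (-(2 : ℝ)) * (‖S‖ * ‖f‖)) :=
    ((integrable_one_add_norm (by simp)).const_mul C).mul_const _
  have key := (hasDerivAt_integral_of_dominated_loc_of_deriv_le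
    (F := fun (y u : ℝ) => ρ (u - y) • A.conjAut u S f)
    (F' := fun (y u : ℝ) => (-ρ' (u - y)) • A.conjAut u S f) (x₀ := (0 : ℝ)) (s := ball 0 1)
    (bound := fun u => C * (1 + ‖u‖) ^ (-(2 : ℝ)) * (‖S‖ * ‖f‖)) (ball_mem_nhds 0 one_pos)
    ?_ ?_ ?_ ?_ hbound ?_).2
  · have e1 : (fun y : ℝ => ∫ u, ρ (u - y) • A.conjAut u S f) =
        fun y => A.conjAut y (conjSmear A ρ S) f :=
      funext fun y => (conjAut_conjSmear_apply' A ρ.integrable S y f).symm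
    have e2 : (∫ u, (-ρ' (u - 0)) • A.conjAut u S f) = (-conjSmear A ρ' S) f := by
      show (∫ u, (-ρ' (u - 0)) • A.conjAut u S f) = -(conjSmear A ρ' S f)
      simp only [sub_zero, neg_smul, integral_neg]
      rw [conjSmear_apply A ρ'.integrable]
    rwa [e1, e2] at key
  · refine Eventually.of_forall fun y => ?_
    exact ((ρ.continuous.comp (continuous_id.sub continuous_const)).smul
      (continuous_conjAut_apply A S f)).aestronglyMeasurable
  · simp only [sub_zero]; exact integrable_smul_conjAut_apply A ρ.integrable S f
  · simp only [sub_zero]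
    exact ((ρ'.continuous.neg).smul (continuous_conjAut_apply A S f)).aestronglyMeasurable
  · refine Eventually.of_forall fun u y hy => ?_
    rw [norm_smul, norm_neg]
    exact mul_le_mul (hC y hy u) ((ContinuousLinearMap.le_opNorm _ _).trans
      (by rw [norm_conjAut])) (norm_nonneg _) (by positivity)
  · refine Eventually.of_forall fun u y _ => ?_
    have h1 : HasDerivAt (fun y : ℝ => u - y) (-1) y := (hasDerivAt_id' y).const_sub u
    have h2 := ((ρ.hasDerivAt (u - y)).scomp y h1).smul_const (A.conjAut u S f)
    simp only [Function.comp_def, neg_smul, one_smul] at h2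
    simp only [hρ', SchwartzMap.derivCLM_apply, neg_smul]
    exact h2

/-! ## §3. Distance to `S` -/

/-- `S_ρ f - S f = ∫ ρ(x) (𝒲(x)[S] f - S f) dx` when `∫ ρ = 1`. [folklore] -/
theorem conjSmear_apply_sub (A : OneParameterUnitaryGroup H) {ρ : ℝ → ℂ} (hρ : Integrable ρ)
    (h1 : ∫ x, ρ x = 1) (S : H →L[ℂ] H) (f : H) :
    conjSmear A ρ S f - S f = ∫ x, ρ x • (A.conjAut x S f - S f) := by
  have h2 : ∫ x, ρ x • S f = S f := by rw [integral_smul_const, h1, one_smul]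
  rw [conjSmear_apply A hρ]
  simp_rw [smul_sub]
  rw [integral_sub (integrable_smul_conjAut_apply A hρ S f) (hρ.smul_const _), h2]

/-- **`‖S_ρ f - S f‖ ≤ (∫ |x| |ρ(x)| dx) ‖[S, iA]‖ ‖f‖`** for `S ∈ C¹(A; H)` and `∫ ρ = 1` (Lipschitz
bound `‖𝒲(x)S - S‖ ≤ |x| ‖[S, iA]‖` of part 7; with `ρ_ε(x) = ε⁻¹ρ(x/ε)` this is `O(ε)`, ABG
Lemma 7.3.6 (a)). [cite: AmreinBoutetdeMonvelGeorgescu1996, Lemma 7.3.6] -/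
theorem norm_conjSmear_apply_sub_le {A : OneParameterUnitaryGroup H} {S D : H →L[ℂ] H}
    (h : A.HasCommutator S D) {ρ : ℝ → ℂ} (hρ : Integrable ρ) (h1 : ∫ x, ρ x = 1)
    (hρ1 : Integrable fun x => |x| * ‖ρ x‖) (f : H) :
    ‖conjSmear A ρ S f - S f‖ ≤ (∫ x, |x| * ‖ρ x‖) * ‖D‖ * ‖f‖ := by
  rw [conjSmear_apply_sub A hρ h1]
  calc ‖∫ x, ρ x • (A.conjAut x S f - S f)‖ ≤ ∫ x, ‖ρ x • (A.conjAut x S f - S f)‖ :=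
        norm_integral_le_integral_norm _
    _ ≤ ∫ x, |x| * ‖ρ x‖ * (‖D‖ * ‖f‖) := by
        refine integral_mono_of_nonneg (Eventually.of_forall fun x => norm_nonneg _)
          (hρ1.mul_const _) (Eventually.of_forall fun x => ?_)
        show ‖ρ x • (A.conjAut x S f - S f)‖ ≤ |x| * ‖ρ x‖ * (‖D‖ * ‖f‖)
        rw [norm_smul]
        calc ‖ρ x‖ * ‖A.conjAut x S f - S f‖ ≤ ‖ρ x‖ * (|x| * ‖D‖ * ‖f‖) := by
              gcongr; exact norm_conjAut_apply_sub_le h x f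
          _ = |x| * ‖ρ x‖ * (‖D‖ * ‖f‖) := by ring
    _ = (∫ x, |x| * ‖ρ x‖) * ‖D‖ * ‖f‖ := by rw [integral_mul_const, mul_assoc]

/-- `𝒲(-x)[[𝒲(x) - 1]² S] = 𝒲(x)[S] - 2S + 𝒲(-x)[S]` (the symmetrised difference). [folklore] -/
theorem conjAut_neg_secondDifference (A : OneParameterUnitaryGroup H) (x : ℝ) (S : H →L[ℂ] H) :
    A.conjAut (-x) (A.secondDifference x S) = A.conjAut x S - (2 : ℂ) • S + A.conjAut (-x) S := by
  simp only [secondDifference, conjAut_sub_op, conjAut_add_op, conjAut_smul_op, ← conjAut_add]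
  have e1 : -x + 2 * x = x := by ring
  rw [e1, neg_add_cancel, conjAut_zero]

/-- The `𝒞^{1,1}` integrand weight `x ↦ |ρ(x)| ‖[𝒲(x) - 1]² S‖` is integrable for integrable `ρ`.
[folklore] -/
theorem integrable_norm_mul_norm_secondDifference (A : OneParameterUnitaryGroup H) {ρ : ℝ → ℂ}
    (hρ : Integrable ρ) (S : H →L[ℂ] H) :
    Integrable fun x => ‖ρ x‖ * ‖A.secondDifference x S‖ :=
  (hρ.norm.mul_const (4 * ‖S‖)).mono'
    (hρ.aestronglyMeasurable.norm.mul (measurable_norm_secondDifference A S).aestronglyMeasurable)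
    (Eventually.of_forall fun x => by
      rw [Real.norm_eq_abs, abs_of_nonneg (by positivity)]
      gcongr
      exact norm_secondDifference_le_four_mul A x S)

/-- **Even kernels see the second difference** (ABG (7.3.17): for even `φ` with `φ(0) = 0`,
`φ(𝒜) = ∫₀^∞ [𝒲(τ) + 𝒲(-τ) - 2] φ̂(τ) dτ`): for even `ρ` with `∫ ρ = 1`,
`S_ρ f - S f = ½ ∫ ρ(x) 𝒲(-x)[[𝒲(x) - 1]² S] f dx`. [cite: AmreinBoutetdeMonvelGeorgescu1996, Lemma 7.3.6] -/
theorem conjSmear_apply_sub_of_even (A : OneParameterUnitaryGroup H) {ρ : ℝ → ℂ}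
    (hρ : Integrable ρ) (h1 : ∫ x, ρ x = 1) (heven : ∀ x, ρ (-x) = ρ x) (S : H →L[ℂ] H) (f : H) :
    conjSmear A ρ S f - S f =
      (1 / 2 : ℂ) • ∫ x, ρ x • A.conjAut (-x) (A.secondDifference x S) f := by
  have hint : ∀ g : ℝ → H →L[ℂ] H, (∀ f, Continuous fun x => g x f) → (∀ x, ‖g x‖ ≤ ‖S‖) →
      Integrable fun x => ρ x • (g x f - S f) := fun g hg hgn =>
    (hρ.norm.mul_const (‖S‖ * ‖f‖ + ‖S f‖)).mono'
      (hρ.aestronglyMeasurable.smul ((hg f).sub continuous_const).aestronglyMeasurable)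
      (Eventually.of_forall fun x => by
        rw [norm_smul]
        gcongr
        exact (norm_sub_le _ _).trans (by
          gcongr; exact (ContinuousLinearMap.le_opNorm _ _).trans (by gcongr; exact hgn x)))
  have hi1 := hint (fun x => A.conjAut x S) (continuous_conjAut_apply A S)
    (fun x => (norm_conjAut A x S).le)
  have hi2 := hint (fun x => A.conjAut (-x) S) (fun f => (continuous_conjAut_apply A S f).comp
    continuous_neg) (fun x => (norm_conjAut A (-x) S).le)
  have e1 := conjSmear_apply_sub A hρ h1 S f
  have e2 : ∫ x, ρ x • (A.conjAut x S f - S f) = ∫ x, ρ x • (A.conjAut (-x) S f - S f) := by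
    rw [← integral_neg_eq_self]
    simp only [heven]
  have e3 : conjSmear A ρ S f - S f = (1 / 2 : ℂ) • ((∫ x, ρ x • (A.conjAut x S f - S f)) +
      ∫ x, ρ x • (A.conjAut (-x) S f - S f)) := by
    rw [← e2, ← e1, ← two_smul ℂ, smul_smul]
    norm_num
  rw [e3, ← integral_add hi1 hi2]
  congr 1
  refine integral_congr_ae (Eventually.of_forall fun x => ?_)
  simp only [conjAut_neg_secondDifference, ← smul_add, _root_.add_apply, _root_.sub_apply,
    two_smul]
  congr 1
  abel

/-- **`‖S_ρ f - S f‖ ≤ ½ (∫ |ρ(x)| ‖[𝒲(x) - 1]² S‖ dx) ‖f‖`** for even `ρ` with `∫ ρ = 1` — the link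
between the regularisation and the class `𝒞^{1,1}(A; H)` (ABG (7.3.21)).
[cite: AmreinBoutetdeMonvelGeorgescu1996, Lemma 7.3.6] -/
theorem norm_conjSmear_apply_sub_le_of_even (A : OneParameterUnitaryGroup H) {ρ : ℝ → ℂ}
    (hρ : Integrable ρ) (h1 : ∫ x, ρ x = 1) (heven : ∀ x, ρ (-x) = ρ x) (S : H →L[ℂ] H) (f : H) :
    ‖conjSmear A ρ S f - S f‖ ≤ 1 / 2 * (∫ x, ‖ρ x‖ * ‖A.secondDifference x S‖) * ‖f‖ := by
  rw [conjSmear_apply_sub_of_even A hρ h1 heven, norm_smul]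
  have h2 : ‖(1 / 2 : ℂ)‖ = 1 / 2 := by norm_num
  rw [h2, mul_assoc]
  gcongr
  calc ‖∫ x, ρ x • A.conjAut (-x) (A.secondDifference x S) f‖
      ≤ ∫ x, ‖ρ x • A.conjAut (-x) (A.secondDifference x S) f‖ := norm_integral_le_integral_norm _
    _ ≤ ∫ x, ‖ρ x‖ * ‖A.secondDifference x S‖ * ‖f‖ := by
        refine integral_mono_of_nonneg (Eventually.of_forall fun x => norm_nonneg _)
          ((integrable_norm_mul_norm_secondDifference A hρ S).mul_const _)
          (Eventually.of_forall fun x => ?_)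
        show ‖ρ x • A.conjAut (-x) (A.secondDifference x S) f‖ ≤ ‖ρ x‖ * ‖A.secondDifference x S‖ * ‖f‖
        rw [mul_assoc]
        exact norm_smul_conjAut_apply_le A (ρ x) (A.secondDifference x S) f (-x)
    _ = (∫ x, ‖ρ x‖ * ‖A.secondDifference x S‖) * ‖f‖ := integral_mul_const _ _

/-! ## §4. Headline (registered helper stub) -/

/-- **Schwartz smearing along the conjugate group regularises, headline form** (all binders
explicit; registered helper stub of `stub_mourreThresholdLAP`; the mechanism of ABG Lemma 7.3.6):
for every Schwartz kernel `ρ` and every bounded `S`, `S_ρ = ∫ ρ(x) 𝒲(x)[S] dx` is of class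
`C¹(A; H)` with `[S_ρ, iA] = -S_{ρ'}`. [cite: AmreinBoutetdeMonvelGeorgescu1996, Lemma 7.3.6] -/
theorem conjSmear_schwartz_regular :
    ∀ (K : Type) [NormedAddCommGroup K] [InnerProductSpace ℂ K] [CompleteSpace K]
      (A : Literature.Analysis.UnboundedOperators.OneParameterUnitaryGroup K) (ρ : SchwartzMap ℝ ℂ)
      (S : K →L[ℂ] K),
      A.IsOfClassC1 (Summit.AtomisticToContinuum.FouriersLaw.Theorems.MourreDissolution.conjSmear A ρ S) ∧
        A.commutatorCLM
            (Summit.AtomisticToContinuum.FouriersLaw.Theorems.MourreDissolution.conjSmear A ρ S) =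
          -Summit.AtomisticToContinuum.FouriersLaw.Theorems.MourreDissolution.conjSmear A
            (SchwartzMap.derivCLM ℂ ℂ ρ) S := by
  intro K _ _ _ A ρ S
  exact ⟨(hasCommutator_conjSmear_schwartz A ρ S).isOfClassC1,
    (hasCommutator_conjSmear_schwartz A ρ S).commutatorCLM_eq⟩

end Summit.AtomisticToContinuum.FouriersLaw.Theorems.MourreDissolution
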